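import Literature.GroupTheory.ArithmeticGroups.IharaAmalgamPingPong
import Mathlib.Algebra.Field.ZMod
import Literature.NumberTheory.Automorphic.CongruenceSubgroupPropertySL2Away
import Mathlib.RingTheory.Localization.Away.Basic
import HarnessLib

/-!
# Ihara's amalgam `Γ̃(N) = Γ(N) *_{Γ(N) ∩ Γ₀(p)} A⁻¹ Γ(N) A ≤ SL₂(ℤ[1/p])` — III: generation

Topic `Literature/GroupTheory/ArithmeticGroups`; namespace
`Literature.GroupTheory.ArithmeticGroups.IharaAmalgam`.  PROOF-ONLY sequel of
`IharaAmalgamPingPong.lean` (no definition, no named fact; D-0026): the SURJECTIVITY half of Ihara's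
theorem [Serre, *Trees*, II.1.4 Thm. 3 and Cor. 1; Ihara 1966] at level `N` — the principal congruence
subgroup `Γ̃(N) = ker (SL₂(ℤ[1/p]) → SL₂(ℤ[1/p]/N))` (`p ∤ N`; the tree's `SL2Rel.Gamma (N)` over
`Localization.Away (p : ℤ)`) is generated by `K₀ = Γ(N)` and `K₁ = A⁻¹ Γ(N) A`, `A = diag(p, 1)`.
Serre's proof: `SL₂(ℤ[1/p])` acts on the tree of `SL₂(ℚ_p)` and the two vertex stabilisers of an
edge generate (II.1.4, via I.4.1 Lemma 5); here the distance from the base vertex `ℤ_p²` is the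
`p`-power DENOMINATOR exponent, and one step towards the base vertex is a row reduction mod `p` by
`Γ(N)` followed by a conjugate row reduction by `A⁻¹ Γ(N) A`.

* `exists_mem_Gamma_mul_row_one_dvd` / `exists_mem_Gamma_mul_row_zero_dvd` — for an integer matrix
  `X` with `p ∣ det X` some `γ ∈ Γ(N)` makes a row of `γ X` divisible by `p` (linear algebra over
  `ℤ/p` + strong approximation `Γ(N) ↠ SL₂(ℤ/p)`, file I);
* `mem_of_eq_map_intCast` (base), `exists_mem_sup_mul_of_succ` (step: `p^{n+1} g = M`,
  `det M = p^{2(n+1)}`, `M ≡ p^{n+1} (mod N)` ⟹ `g = k g₂`, `k ∈ K₀ ⊔ K₁`, `p^n g₂` of the same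
  shape), `mem_sup_of_smul_eq_map` (the induction) — all in `GL₂(ℚ)` with integer matrices, the
  congruence carried as `M.map (ℤ → ℤ/N) = p^n • 1`;
* `exists_pow_mul_eq_algebraMap`, `toGL_map_mem_sup` — the bridge from `SL₂(ℤ[1/p])`
  (`Localization.Away (p : ℤ)`, any ring map `θ : ℤ[1/p] → ℚ`): **every element of `Γ̃(N)` maps into
  `K₀ ⊔ K₁`**.

With files I–II: `⟨Γ(N), A⁻¹ Γ(N) A⟩ ≅ Γ(N) *_{Γ(N) ∩ Γ₀(p)} A⁻¹ Γ(N) A` contains the image of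
`Γ̃(N)` (and is contained in it), which is Serre's Cor. 1; the K★ stub `stub_hker2` (CDT Lemma
4.4.1 / 4.6.2) combines this with the tree's congruence subgroup property of `SL₂(ℤ[1/p])`
(`SerreSL2Congruence1970_congruenceSubgroupProperty_away_holds`).

## References

* [Serre1980Trees] J.-P. Serre, *Trees*, Springer 1980, II.1.4 Thm. 3 and Cor. 1 (with I.4.1 Lemma 5).
* [Ihara1966DiscreteSubgroups] Y. Ihara, J. Math. Soc. Japan 18 (1966) 219–235, Thm. 1.
-/

namespace Literature.GroupTheory.ArithmeticGroups

namespace IharaAmalgam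

open scoped MatrixGroups
open Matrix.SpecialLinearGroup CongruenceSubgroup

/-! ### Row reduction modulo `p` by elements of `Γ(N)` -/

section RowKill

variable {N p : ℕ} [Fact p.Prime]

/-- Divisibility by `p` as vanishing in `ℤ/p`. [folklore] -/
private lemma dvd_iff_cast_eq_zero {z : ℤ} : (p : ℤ) ∣ z ↔ (z : ZMod p) = 0 :=
  (ZMod.intCast_zmod_eq_zero_iff_dvd z p).symm

/-- **Row reduction mod `p`.** For an integer `2 × 2` matrix `X` with `p ∣ det X` there is
`B ∈ SL₂(ℤ)` such that the second row of `B X` is divisible by `p`. [folklore] -/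
private lemma exists_sl2_mul_row_one_dvd (X : Matrix (Fin 2) (Fin 2) ℤ) (hX : (p : ℤ) ∣ X.det) :
    ∃ B : SL(2, ℤ), (p : ℤ) ∣ ((B : Matrix (Fin 2) (Fin 2) ℤ) * X) 1 0 ∧
      (p : ℤ) ∣ ((B : Matrix (Fin 2) (Fin 2) ℤ) * X) 1 1 := by
  have hdet : (X 0 0 : ZMod p) * (X 1 1 : ZMod p) - (X 0 1 : ZMod p) * (X 1 0 : ZMod p) = 0 := by
    have h : ((X.det : ℤ) : ZMod p) = 0 := dvd_iff_cast_eq_zero.mp hX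
    rw [Matrix.det_fin_two] at h
    push_cast at h
    exact h
  by_cases h1 : (p : ℤ) ∣ X 1 0 ∧ (p : ℤ) ∣ X 1 1
  · exact ⟨1, by simpa using h1.1, by simpa using h1.2⟩
  · -- second row `r₁ ≠ 0 mod p`; then `r₀ = λ r₁`
    obtain ⟨l, hl0, hl1⟩ : ∃ l : ZMod p, (X 0 0 : ZMod p) = l * (X 1 0 : ZMod p) ∧
        (X 0 1 : ZMod p) = l * (X 1 1 : ZMod p) := by
      by_cases hc : (X 1 0 : ZMod p) = 0
      · have hd : (X 1 1 : ZMod p) ≠ 0 := by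
          intro hd; exact h1 ⟨dvd_iff_cast_eq_zero.mpr hc, dvd_iff_cast_eq_zero.mpr hd⟩
        refine ⟨(X 0 1 : ZMod p) * (X 1 1 : ZMod p)⁻¹, ?_, ?_⟩
        · rw [hc, mul_zero]
          have : (X 0 0 : ZMod p) * (X 1 1 : ZMod p) = 0 := by
            rw [hc, mul_zero, sub_zero] at hdet; exact hdet
          exact (mul_eq_zero.mp this).resolve_right hd
        · rw [inv_mul_cancel_right₀ hd]
      · refine ⟨(X 0 0 : ZMod p) * (X 1 0 : ZMod p)⁻¹, ?_, ?_⟩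
        · rw [inv_mul_cancel_right₀ hc]
        · rw [mul_right_comm, show (X 0 0 : ZMod p) * (X 1 1 : ZMod p) = (X 0 1 : ZMod p) * (X 1 0 : ZMod p)
            from by linear_combination hdet, mul_inv_cancel_right₀ hc]
    -- `B = [0, -1; 1, -λ]`
    let B : SL(2, ℤ) := ⟨!![0, -1; 1, -(l.val : ℤ)], by norm_num [Matrix.det_fin_two_of]⟩
    have hlv : ((l.val : ℤ) : ZMod p) = l := by simp
    refine ⟨B, ?_, ?_⟩
    · rw [dvd_iff_cast_eq_zero]
      simp [B, Matrix.mul_apply, Fin.sum_univ_two]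
      rw [hl0]; ring
    · rw [dvd_iff_cast_eq_zero]
      simp [B, Matrix.mul_apply, Fin.sum_univ_two]
      rw [hl1]; ring

/-- Row reduction of the FIRST row: compose with the Weyl element. [folklore] -/
private lemma exists_sl2_mul_row_zero_dvd (X : Matrix (Fin 2) (Fin 2) ℤ) (hX : (p : ℤ) ∣ X.det) :
    ∃ B : SL(2, ℤ), (p : ℤ) ∣ ((B : Matrix (Fin 2) (Fin 2) ℤ) * X) 0 0 ∧
      (p : ℤ) ∣ ((B : Matrix (Fin 2) (Fin 2) ℤ) * X) 0 1 := by
  obtain ⟨B, h0, h1⟩ := exists_sl2_mul_row_one_dvd X hX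
  let w : SL(2, ℤ) := ⟨!![0, -1; 1, 0], by norm_num [Matrix.det_fin_two_of]⟩
  refine ⟨w * B, ?_, ?_⟩
  · rw [Matrix.SpecialLinearGroup.coe_mul, Matrix.mul_assoc]
    have : ((w : Matrix (Fin 2) (Fin 2) ℤ) * ((B : Matrix (Fin 2) (Fin 2) ℤ) * X)) 0 0 =
        -(((B : Matrix (Fin 2) (Fin 2) ℤ) * X) 1 0) := by
      simp [w, Matrix.mul_apply, Fin.sum_univ_two]
    rw [this]; exact (dvd_neg).mpr h0
  · rw [Matrix.SpecialLinearGroup.coe_mul, Matrix.mul_assoc]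
    have : ((w : Matrix (Fin 2) (Fin 2) ℤ) * ((B : Matrix (Fin 2) (Fin 2) ℤ) * X)) 0 1 =
        -(((B : Matrix (Fin 2) (Fin 2) ℤ) * X) 1 1) := by
      simp [w, Matrix.mul_apply, Fin.sum_univ_two]
    rw [this]; exact (dvd_neg).mpr h1

/-- Transfer: if `γ ≡ B (mod p)` entrywise then `p ∣ (B X) i j ↔ p ∣ (γ X) i j`. [folklore] -/
private lemma dvd_mul_apply_of_forall_dvd_sub {γ B : SL(2, ℤ)} (h : ∀ i j, (p : ℤ) ∣ γ i j - B i j)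
    (X : Matrix (Fin 2) (Fin 2) ℤ) {i j : Fin 2}
    (hB : (p : ℤ) ∣ ((B : Matrix (Fin 2) (Fin 2) ℤ) * X) i j) :
    (p : ℤ) ∣ ((γ : Matrix (Fin 2) (Fin 2) ℤ) * X) i j := by
  have hc : ∀ i j, (γ i j : ZMod p) = (B i j : ZMod p) := fun i j ↦ by
    have := (ZMod.intCast_zmod_eq_zero_iff_dvd _ p).mpr (h i j)
    rwa [Int.cast_sub, sub_eq_zero] at this
  rw [dvd_iff_cast_eq_zero] at hB ⊢
  rw [Matrix.mul_apply, Fin.sum_univ_two] at hB ⊢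
  push_cast at hB ⊢
  rw [hc, hc]
  exact hB

/-- **Row reduction by `Γ(N)`** (`gcd(N, p) = 1`): some `γ ∈ Γ(N)` makes the second row of `γ X`
divisible by `p` (`p ∣ det X`). [cite: Serre1980Trees, II.1.4 Cor. 1 (proof)] -/
theorem exists_mem_Gamma_mul_row_one_dvd (hNp : N.Coprime p) (X : Matrix (Fin 2) (Fin 2) ℤ)
    (hX : (p : ℤ) ∣ X.det) :
    ∃ γ ∈ Gamma N, (p : ℤ) ∣ ((γ : Matrix (Fin 2) (Fin 2) ℤ) * X) 1 0 ∧
      (p : ℤ) ∣ ((γ : Matrix (Fin 2) (Fin 2) ℤ) * X) 1 1 := by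
  obtain ⟨B, h0, h1⟩ := exists_sl2_mul_row_one_dvd X hX
  obtain ⟨γ, hγ, hγB⟩ := exists_mem_Gamma_forall_dvd_sub hNp B
  exact ⟨γ, hγ, dvd_mul_apply_of_forall_dvd_sub hγB X h0, dvd_mul_apply_of_forall_dvd_sub hγB X h1⟩

/-- **Row reduction by `Γ(N)`**, first row. [cite: Serre1980Trees, II.1.4 Cor. 1 (proof)] -/
theorem exists_mem_Gamma_mul_row_zero_dvd (hNp : N.Coprime p) (X : Matrix (Fin 2) (Fin 2) ℤ)
    (hX : (p : ℤ) ∣ X.det) :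
    ∃ γ ∈ Gamma N, (p : ℤ) ∣ ((γ : Matrix (Fin 2) (Fin 2) ℤ) * X) 0 0 ∧
      (p : ℤ) ∣ ((γ : Matrix (Fin 2) (Fin 2) ℤ) * X) 0 1 := by
  obtain ⟨B, h0, h1⟩ := exists_sl2_mul_row_zero_dvd X hX
  obtain ⟨γ, hγ, hγB⟩ := exists_mem_Gamma_forall_dvd_sub hNp B
  exact ⟨γ, hγ, dvd_mul_apply_of_forall_dvd_sub hγB X h0, dvd_mul_apply_of_forall_dvd_sub hγB X h1⟩

end RowKill

/-! ### Generation of `Γ̃(N)` by `Γ(N)` and `A⁻¹ Γ(N) A`: the denominator induction -/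

section Generation

variable {N p : ℕ} [Fact p.Prime] {A : GL (Fin 2) ℚ} {K₀ K₁ : Subgroup (GL (Fin 2) ℚ)}

/-- Base of the induction: an integral `g ∈ GL₂(ℚ)` of determinant one congruent to `1 mod N` lies in
`K₀ = Γ(N)`. [cite: Serre1980Trees, II.1.4 (`Γ ∩ SL₂(ℤ_p) = SL₂(ℤ)`)] -/
theorem mem_of_eq_map_intCast (hK₀ : ∀ g, g ∈ K₀ ↔ ∃ γ ∈ Gamma N, mapGL ℚ γ = g)
    (M : Matrix (Fin 2) (Fin 2) ℤ) (g : GL (Fin 2) ℚ)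
    (hg : (g : Matrix (Fin 2) (Fin 2) ℚ) = M.map (Int.castRingHom ℚ)) (hdet : M.det = 1)
    (hcong : M.map (Int.castRingHom (ZMod N)) = 1) : g ∈ K₀ := by
  refine (hK₀ g).mpr ⟨⟨M, hdet⟩, ?_, ?_⟩
  · rw [Gamma_mem']
    ext i j
    exact congrFun (congrFun hcong i) j
  · apply Units.ext
    rw [hg]
    ext i j
    simp [mapGL_rat_apply]

/-- **Denominator reduction** (the induction step of Serre's proof that `SL₂(ℤ)` and `A⁻¹ SL₂(ℤ) A`
generate `SL₂(ℤ[1/p])`, at level `N`): if `g ∈ GL₂(ℚ)` has `p^{n+1} g = M` integral with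
`det M = p^{2(n+1)}` and `M ≡ p^{n+1} (mod N)`, then `g = k g₂` with `k ∈ K₀ ⊔ K₁` and `p^n g₂`
integral of the same shape. [cite: Serre1980Trees, II.1.4 Thm. 3 (proof) and Cor. 1] -/
theorem exists_mem_sup_mul_of_succ (hNp : N.Coprime p)
    (hA : (A : Matrix (Fin 2) (Fin 2) ℚ) = !![(p : ℚ), 0; 0, 1])
    (hK₀ : ∀ g, g ∈ K₀ ↔ ∃ γ ∈ Gamma N, mapGL ℚ γ = g) (hK₁ : ∀ g, g ∈ K₁ ↔ A * g * A⁻¹ ∈ K₀)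
    (n : ℕ) (M : Matrix (Fin 2) (Fin 2) ℤ) (g : GL (Fin 2) ℚ)
    (hg : (p : ℚ) ^ (n + 1) • (g : Matrix (Fin 2) (Fin 2) ℚ) = M.map (Int.castRingHom ℚ))
    (hdet : M.det = (p : ℤ) ^ (2 * (n + 1)))
    (hcong : M.map (Int.castRingHom (ZMod N)) = (p : ZMod N) ^ (n + 1) • (1 : Matrix (Fin 2) (Fin 2) (ZMod N))) :
    ∃ (k g₂ : GL (Fin 2) ℚ) (M₂ : Matrix (Fin 2) (Fin 2) ℤ), k ∈ K₀ ⊔ K₁ ∧ g = k * g₂ ∧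
      (p : ℚ) ^ n • (g₂ : Matrix (Fin 2) (Fin 2) ℚ) = M₂.map (Int.castRingHom ℚ) ∧
      M₂.det = (p : ℤ) ^ (2 * n) ∧
      M₂.map (Int.castRingHom (ZMod N)) = (p : ZMod N) ^ n • (1 : Matrix (Fin 2) (Fin 2) (ZMod N)) := by
  have hp : p.Prime := Fact.out
  have hp0 : (p : ℤ) ≠ 0 := by exact_mod_cast hp.ne_zero
  have hpq : (p : ℚ) ≠ 0 := by exact_mod_cast hp.ne_zero
  have hpu : IsUnit (p : ZMod N) := (ZMod.isUnit_iff_coprime p N).mpr hNp.symm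
  -- Step 1: `γ ∈ Γ(N)` killing the second row of `M` mod `p`
  have hpdet : (p : ℤ) ∣ M.det := by
    rw [hdet, show 2 * (n + 1) = 2 * n + 1 + 1 by ring, pow_succ]; exact dvd_mul_left _ _
  obtain ⟨γ, hγ, ⟨c, hc⟩, ⟨d, hd⟩⟩ := exists_mem_Gamma_mul_row_one_dvd hNp M hpdet
  set M' : Matrix (Fin 2) (Fin 2) ℤ := (γ : Matrix (Fin 2) (Fin 2) ℤ) * M with hM'
  -- `M₁ = A M' / p`
  let M₁ : Matrix (Fin 2) (Fin 2) ℤ := !![M' 0 0, M' 0 1; c, d]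
  have hDM' : !![(p : ℤ), 0; 0, 1] * M' = (p : ℤ) • M₁ := by
    ext i j; fin_cases i <;> fin_cases j <;>
      simp [M₁, Matrix.mul_apply, Fin.sum_univ_two, hc, hd]
  have hdetM' : M'.det = (p : ℤ) ^ (2 * (n + 1)) := by
    rw [hM', Matrix.det_mul, γ.det_coe, one_mul, hdet]
  have hdet₁ : M₁.det = (p : ℤ) ^ (2 * n + 1) := by
    have h1 : M'.det = p * M₁.det := by
      rw [Matrix.det_fin_two, Matrix.det_fin_two]
      simp only [M₁, Matrix.of_apply, Matrix.cons_val', Matrix.cons_val_zero, Matrix.cons_val_one,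
        Matrix.cons_val_fin_one, Matrix.empty_val']
      rw [hc, hd]; ring
    have h2 : (p : ℤ) * M₁.det = p * p ^ (2 * n + 1) := by
      rw [← h1, hdetM']; ring
    exact mul_left_cancel₀ hp0 h2
  -- Step 2: `γ₂ ∈ Γ(N)` killing the first row of `M₁` mod `p`
  have hpdet₁ : (p : ℤ) ∣ M₁.det := by rw [hdet₁, pow_succ]; exact dvd_mul_left _ _
  obtain ⟨γ₂, hγ₂, ⟨u, hu⟩, ⟨v, hv⟩⟩ := exists_mem_Gamma_mul_row_zero_dvd hNp M₁ hpdet₁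
  let M₂ : Matrix (Fin 2) (Fin 2) ℤ :=
    !![u, v; ((γ₂ : Matrix (Fin 2) (Fin 2) ℤ) * M₁) 1 0, ((γ₂ : Matrix (Fin 2) (Fin 2) ℤ) * M₁) 1 1]
  have hDM₂ : (γ₂ : Matrix (Fin 2) (Fin 2) ℤ) * M₁ = !![(p : ℤ), 0; 0, 1] * M₂ := by
    ext i j; fin_cases i <;> fin_cases j <;>
      simp [M₂, Matrix.mul_apply, Fin.sum_univ_two, hu, hv]
  have hdet₂ : M₂.det = (p : ℤ) ^ (2 * n) := by
    have h1 : ((γ₂ : Matrix (Fin 2) (Fin 2) ℤ) * M₁).det = p * M₂.det := by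
      rw [hDM₂, Matrix.det_mul, Matrix.det_fin_two_of]; ring
    rw [Matrix.det_mul, γ₂.det_coe, one_mul, hdet₁, pow_succ, mul_comm] at h1
    exact (mul_left_cancel₀ hp0 h1).symm
  -- the two elements of `K₀`, `K₁`
  have hk₀ : mapGL ℚ γ ∈ K₀ := (hK₀ _).mpr ⟨γ, hγ, rfl⟩
  have hk₁ : A⁻¹ * mapGL ℚ γ₂ * A ∈ K₁ := (mem_iff_exists_conj hK₀ hK₁ _).mpr ⟨γ₂, hγ₂, rfl⟩
  let g₂ : GL (Fin 2) ℚ := A⁻¹ * mapGL ℚ γ₂ * A * mapGL ℚ γ * g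
  refine ⟨(mapGL ℚ γ)⁻¹ * (A⁻¹ * mapGL ℚ γ₂ * A)⁻¹, g₂, M₂,
    Subgroup.mul_mem _ (Subgroup.inv_mem _ (Subgroup.mem_sup_left hk₀))
      (Subgroup.inv_mem _ (Subgroup.mem_sup_right hk₁)), by simp only [g₂]; group, ?_, hdet₂, ?_⟩
  · -- the `ℚ`-matrix identity `p^n g₂ = M₂`
    have hγq : ((mapGL ℚ γ : GL (Fin 2) ℚ) : Matrix (Fin 2) (Fin 2) ℚ) =
        (γ : Matrix (Fin 2) (Fin 2) ℤ).map (Int.castRingHom ℚ) := by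
      ext i j; simp [mapGL_rat_apply]
    have hγ₂q : ((mapGL ℚ γ₂ : GL (Fin 2) ℚ) : Matrix (Fin 2) (Fin 2) ℚ) =
        (γ₂ : Matrix (Fin 2) (Fin 2) ℤ).map (Int.castRingHom ℚ) := by
      ext i j; simp [mapGL_rat_apply]
    have hAq : (A : Matrix (Fin 2) (Fin 2) ℚ) = (!![(p : ℤ), 0; 0, 1] : Matrix (Fin 2) (Fin 2) ℤ).map (Int.castRingHom ℚ) := by
      rw [hA]; ext i j; fin_cases i <;> fin_cases j <;> simp
    -- `A M' = p M₁` and `γ₂ M₁ = A M₂` over `ℚ`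
    have h1 : (A : Matrix (Fin 2) (Fin 2) ℚ) * M'.map (Int.castRingHom ℚ) = (p : ℚ) • M₁.map (Int.castRingHom ℚ) := by
      rw [hAq, ← Matrix.map_mul, hDM']
      ext i j
      rw [Matrix.map_apply, Matrix.smul_apply, Matrix.smul_apply, Matrix.map_apply, smul_eq_mul,
        smul_eq_mul, map_mul, map_natCast]
    have h2 : (γ₂ : Matrix (Fin 2) (Fin 2) ℤ).map (Int.castRingHom ℚ) * M₁.map (Int.castRingHom ℚ) =
        (A : Matrix (Fin 2) (Fin 2) ℚ) * M₂.map (Int.castRingHom ℚ) := by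
      rw [← Matrix.map_mul, hDM₂, Matrix.map_mul, hAq]
    apply smul_right_injective (Matrix (Fin 2) (Fin 2) ℚ) hpq
    change (p : ℚ) • ((p : ℚ) ^ n • (g₂ : Matrix (Fin 2) (Fin 2) ℚ)) = (p : ℚ) • M₂.map (Int.castRingHom ℚ)
    rw [smul_smul, ← pow_succ']
    calc (p : ℚ) ^ (n + 1) • (g₂ : Matrix (Fin 2) (Fin 2) ℚ)
        = (A⁻¹ : GL (Fin 2) ℚ) * ((mapGL ℚ γ₂ : GL (Fin 2) ℚ) * ((A : Matrix (Fin 2) (Fin 2) ℚ) *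
            ((mapGL ℚ γ : GL (Fin 2) ℚ) * ((p : ℚ) ^ (n + 1) • (g : Matrix (Fin 2) (Fin 2) ℚ))))) := by
          simp only [g₂, Units.val_mul, Matrix.mul_smul, Matrix.mul_assoc]
      _ = (A⁻¹ : GL (Fin 2) ℚ) * ((mapGL ℚ γ₂ : GL (Fin 2) ℚ) * ((A : Matrix (Fin 2) (Fin 2) ℚ) *
            M'.map (Int.castRingHom ℚ))) := by
          rw [hg, hγq, ← Matrix.map_mul]
      _ = (p : ℚ) • ((A⁻¹ : GL (Fin 2) ℚ) * ((A : Matrix (Fin 2) (Fin 2) ℚ) * M₂.map (Int.castRingHom ℚ))) := by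
          rw [h1, Matrix.mul_smul, hγ₂q, h2, Matrix.mul_smul]
      _ = (p : ℚ) • M₂.map (Int.castRingHom ℚ) := by
          rw [← Matrix.mul_assoc, Units.inv_mul, Matrix.one_mul]
  · -- the congruence `M₂ ≡ p^n (mod N)`
    have hγN : (γ : Matrix (Fin 2) (Fin 2) ℤ).map (Int.castRingHom (ZMod N)) = 1 := by
      have := Gamma_mem'.mp hγ
      exact congrArg Subtype.val this
    have hγ₂N : (γ₂ : Matrix (Fin 2) (Fin 2) ℤ).map (Int.castRingHom (ZMod N)) = 1 := by
      have := Gamma_mem'.mp hγ₂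
      exact congrArg Subtype.val this
    have hM'N : M'.map (Int.castRingHom (ZMod N)) = (p : ZMod N) ^ (n + 1) • (1 : Matrix (Fin 2) (Fin 2) (ZMod N)) := by
      rw [hM', Matrix.map_mul, hγN, Matrix.one_mul, hcong]
    -- cast `A M' = p M₁` and `γ₂ M₁ = A M₂` to `ℤ/N`
    have hD : (!![(p : ℤ), 0; 0, 1] : Matrix (Fin 2) (Fin 2) ℤ).map (Int.castRingHom (ZMod N)) =
        !![(p : ZMod N), 0; 0, 1] := by
      ext i j; fin_cases i <;> fin_cases j <;> simp
    have h1 : !![(p : ZMod N), 0; 0, 1] * M'.map (Int.castRingHom (ZMod N)) =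
        (p : ZMod N) • M₁.map (Int.castRingHom (ZMod N)) := by
      rw [← hD, ← Matrix.map_mul, hDM']
      ext i j
      rw [Matrix.map_apply, Matrix.smul_apply, Matrix.smul_apply, Matrix.map_apply, smul_eq_mul,
        smul_eq_mul, map_mul, map_natCast]
    have h2 : M₁.map (Int.castRingHom (ZMod N)) = !![(p : ZMod N), 0; 0, 1] * M₂.map (Int.castRingHom (ZMod N)) := by
      rw [← hD, ← Matrix.map_mul, ← hDM₂, Matrix.map_mul, hγ₂N, Matrix.one_mul]
    rw [hM'N, h2, Matrix.mul_smul, Matrix.mul_one] at h1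
    -- `h1 : p^{n+1} • D = p • (D * M̄₂)`; cancel `p`, then multiply by `D' = diag(1, p)`
    have h3 : !![(p : ZMod N), 0; 0, 1] * M₂.map (Int.castRingHom (ZMod N)) =
        (p : ZMod N) ^ n • !![(p : ZMod N), 0; 0, 1] := by
      rw [pow_succ', ← smul_smul] at h1
      exact (hpu.smul_left_cancel.mp h1).symm
    have hDD : !![(1 : ZMod N), 0; 0, p] * !![(p : ZMod N), 0; 0, 1] = (p : ZMod N) • (1 : Matrix (Fin 2) (Fin 2) (ZMod N)) := by
      ext i j; fin_cases i <;> fin_cases j <;> simp [Matrix.mul_apply, Fin.sum_univ_two, Matrix.smul_apply]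
    have h4 := congrArg (fun X ↦ !![(1 : ZMod N), 0; 0, p] * X) h3
    rw [← Matrix.mul_assoc, hDD, Matrix.mul_smul, hDD, Matrix.smul_mul, Matrix.one_mul, smul_smul,
      ← pow_succ, pow_succ', ← smul_smul] at h4
    exact hpu.smul_left_cancel.mp h4

/-- **Generation** (Serre, *Trees* II.1.4 Thm. 3 / Cor. 1, the surjectivity half of Ihara's
theorem, at level `N`): every `g ∈ GL₂(ℚ)` of determinant one with `p`-power denominators,
`p^n g = M ∈ M₂(ℤ)`, `det M = p^{2n}`, and `M ≡ p^n (mod N)` (i.e. `g ≡ 1 (mod N ℤ[1/p])`) lies in the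
subgroup generated by `K₀ = Γ(N)` and `K₁ = A⁻¹ Γ(N) A`. [cite: Serre1980Trees, II.1.4 Thm. 3 and Cor. 1] -/
theorem mem_sup_of_smul_eq_map (hNp : N.Coprime p)
    (hA : (A : Matrix (Fin 2) (Fin 2) ℚ) = !![(p : ℚ), 0; 0, 1])
    (hK₀ : ∀ g, g ∈ K₀ ↔ ∃ γ ∈ Gamma N, mapGL ℚ γ = g) (hK₁ : ∀ g, g ∈ K₁ ↔ A * g * A⁻¹ ∈ K₀)
    (n : ℕ) : ∀ (M : Matrix (Fin 2) (Fin 2) ℤ) (g : GL (Fin 2) ℚ),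
      (p : ℚ) ^ n • (g : Matrix (Fin 2) (Fin 2) ℚ) = M.map (Int.castRingHom ℚ) →
      M.det = (p : ℤ) ^ (2 * n) →
      M.map (Int.castRingHom (ZMod N)) = (p : ZMod N) ^ n • (1 : Matrix (Fin 2) (Fin 2) (ZMod N)) →
      g ∈ K₀ ⊔ K₁ := by
  induction n with
  | zero =>
    intro M g hg hdet hcong
    rw [pow_zero, one_smul] at hg hcong
    rw [mul_zero, pow_zero] at hdet
    exact Subgroup.mem_sup_left (mem_of_eq_map_intCast hK₀ M g hg hdet hcong)
  | succ n ih =>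
    intro M g hg hdet hcong
    obtain ⟨k, g₂, M₂, hk, rfl, h1, h2, h3⟩ := exists_mem_sup_mul_of_succ hNp hA hK₀ hK₁ n M g hg hdet hcong
    exact Subgroup.mul_mem _ hk (ih M₂ g₂ h1 h2 h3)

end Generation

/-! ### The bridge to `SL₂(ℤ[1/p])`: `Γ̃(N) ≤ ⟨Γ(N), A⁻¹ Γ(N) A⟩` -/

section Away

variable {N p : ℕ} [Fact p.Prime] {A : GL (Fin 2) ℚ} {K₀ K₁ : Subgroup (GL (Fin 2) ℚ)}

omit [Fact p.Prime] in
/-- Common `p`-power denominator for an element of `SL₂(ℤ[1/p])`: `p^n g = M` with `M` integral.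
[cite: Serre1980Trees, II.1.4 (the group `SL₂(ℤ[1/p])`)] -/
theorem exists_pow_mul_eq_algebraMap (g : SL(2, Localization.Away (p : ℤ))) :
    ∃ (n : ℕ) (M : Matrix (Fin 2) (Fin 2) ℤ), ∀ i j,
      (algebraMap ℤ (Localization.Away (p : ℤ))) (M i j) = (p : Localization.Away (p : ℤ)) ^ n * g i j := by
  -- clear the denominator of each entry
  have key : ∀ x : Localization.Away (p : ℤ), ∃ (k : ℕ) (a : ℤ),
      (algebraMap ℤ (Localization.Away (p : ℤ))) a = (p : Localization.Away (p : ℤ)) ^ k * x := by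
    intro x
    obtain ⟨⟨a, s⟩, has⟩ := IsLocalization.surj (Submonoid.powers (p : ℤ)) x
    obtain ⟨k, hk⟩ := (Submonoid.mem_powers_iff _ _).mp s.2
    refine ⟨k, a, ?_⟩
    rw [← has, mul_comm]
    congr 1
    rw [← hk, map_pow, map_natCast]
  choose k a hka using key
  -- total exponent
  let n : ℕ := k (g 0 0) + k (g 0 1) + k (g 1 0) + k (g 1 1)
  have hle : ∀ i j, k (g i j) ≤ n := by
    intro i j; fin_cases i <;> fin_cases j <;> simp only [n, Fin.zero_eta, Fin.mk_one, Fin.isValue] <;> omega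
  refine ⟨n, Matrix.of fun i j ↦ a (g i j) * (p : ℤ) ^ (n - k (g i j)), fun i j ↦ ?_⟩
  rw [Matrix.of_apply, map_mul, hka, map_pow, map_natCast]
  rw [mul_right_comm, ← pow_add, Nat.add_sub_cancel' (hle i j)]

/-- **Ihara–Serre: `Γ̃(N) ≤ ⟨Γ(N), A⁻¹ Γ(N) A⟩`.** Every element of the principal congruence subgroup
of level `N` of `SL₂(ℤ[1/p])` (`p ∤ N`), pushed into `GL₂(ℚ)`, lies in the subgroup generated by
`K₀ = Γ(N)` and `K₁ = A⁻¹ Γ(N) A`; with files I–II, `⟨Γ(N), A⁻¹ Γ(N) A⟩ = Γ̃(N)` IS the amalgam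
`Γ(N) *_{Γ(N) ∩ Γ₀(p)} A⁻¹ Γ(N) A`. [cite: Serre1980Trees, II.1.4 Thm. 3 and Cor. 1]
[cite: Ihara1966DiscreteSubgroups, Thm. 1] -/
theorem toGL_map_mem_sup (hNp : N.Coprime p)
    (hA : (A : Matrix (Fin 2) (Fin 2) ℚ) = !![(p : ℚ), 0; 0, 1])
    (hK₀ : ∀ g, g ∈ K₀ ↔ ∃ γ ∈ Gamma N, mapGL ℚ γ = g) (hK₁ : ∀ g, g ∈ K₁ ↔ A * g * A⁻¹ ∈ K₀)
    (θ : Localization.Away (p : ℤ) →+* ℚ) (g : SL(2, Localization.Away (p : ℤ)))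
    (hg : g ∈ Literature.NumberTheory.Automorphic.SL2Rel.Gamma
      (Ideal.span {(N : Localization.Away (p : ℤ))})) :
    Matrix.SpecialLinearGroup.toGL (Matrix.SpecialLinearGroup.map θ g) ∈ K₀ ⊔ K₁ := by
  have hp : p.Prime := Fact.out
  obtain ⟨n, M, hM⟩ := exists_pow_mul_eq_algebraMap g
  have hθz : ∀ z : ℤ, θ (algebraMap ℤ (Localization.Away (p : ℤ)) z) = z := fun z ↦ by simp
  have hθp : θ (p : Localization.Away (p : ℤ)) = p := by simp
  -- the `ℚ`-matrix identity
  have hq : (p : ℚ) ^ n • ((Matrix.SpecialLinearGroup.toGL (Matrix.SpecialLinearGroup.map θ g) :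
      GL (Fin 2) ℚ) : Matrix (Fin 2) (Fin 2) ℚ) = M.map (Int.castRingHom ℚ) := by
    ext i j
    simp only [Matrix.smul_apply, Matrix.map_apply, eq_intCast, smul_eq_mul,
      Matrix.SpecialLinearGroup.coe_GL_coe_matrix, Matrix.SpecialLinearGroup.map_apply_coe,
      RingHom.mapMatrix_apply]
    rw [← hθz, hM, map_mul, map_pow, hθp]
  -- the determinant
  have hdet : M.det = (p : ℤ) ^ (2 * n) := by
    have h1 : (M.map (Int.castRingHom ℚ)).det = (p : ℚ) ^ (2 * n) := by
      rw [← hq, Matrix.det_smul, Matrix.SpecialLinearGroup.coe_GL_coe_matrix,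
        Matrix.SpecialLinearGroup.det_coe, mul_one, Fintype.card_fin, pow_mul']
    have h2 : (Int.castRingHom ℚ) M.det = (p : ℚ) ^ (2 * n) := by
      rw [RingHom.map_det, RingHom.mapMatrix_apply, h1]
    rw [eq_intCast] at h2
    exact_mod_cast h2
  -- the congruence mod `N`
  have hcong : ∀ i j, (N : ℤ) ∣ M i j - (p : ℤ) ^ n * (1 : Matrix (Fin 2) (Fin 2) ℤ) i j := by
    have hinj := Literature.NumberTheory.Automorphic.algebraMap_int_away_injective (m := p) hp.ne_zero
    rw [Literature.NumberTheory.Automorphic.SL2Rel.mem_Gamma] at hg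
    have key : ∀ i j (x : Localization.Away (p : ℤ)), x ∈ Ideal.span {(N : Localization.Away (p : ℤ))} →
        (algebraMap ℤ _) (M i j) = (p : Localization.Away (p : ℤ)) ^ n * (x + (1 : Matrix (Fin 2) (Fin 2) ℤ) i j) →
        (N : ℤ) ∣ M i j - (p : ℤ) ^ n * (1 : Matrix (Fin 2) (Fin 2) ℤ) i j := by
      intro i j x hx hMx
      obtain ⟨r, hr⟩ := Ideal.mem_span_singleton'.mp hx
      obtain ⟨⟨b, s⟩, hbs⟩ := IsLocalization.surj (Submonoid.powers (p : ℤ)) r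
      obtain ⟨m, hm⟩ := (Submonoid.mem_powers_iff _ _).mp s.2
      -- `(M i j - p^n δ) p^m = N p^n b` in `ℤ`
      have h1 : (algebraMap ℤ (Localization.Away (p : ℤ)))
          ((M i j - (p : ℤ) ^ n * (1 : Matrix (Fin 2) (Fin 2) ℤ) i j) * (p : ℤ) ^ m) =
          (algebraMap ℤ (Localization.Away (p : ℤ))) ((N : ℤ) * ((p : ℤ) ^ n * b)) := by
        have hb : r * (p : Localization.Away (p : ℤ)) ^ m = (b : Localization.Away (p : ℤ)) := by
          rw [← eq_intCast (algebraMap ℤ (Localization.Away (p : ℤ))) b, ← hbs]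
          congr 1; rw [← hm, map_pow, map_natCast]
        simp only [map_mul, map_sub, map_pow, map_natCast, eq_intCast, hMx, ← hr]
        rw [← hb]; ring
      have h2 := hinj h1
      have hcop : IsCoprime (N : ℤ) ((p : ℤ) ^ m) :=
        (Nat.isCoprime_iff_coprime.mpr (hNp.pow_right m))
      exact hcop.dvd_of_dvd_mul_right ⟨(p : ℤ) ^ n * b, h2⟩
    intro i j
    fin_cases i <;> fin_cases j
    · exact key 0 0 _ hg.2.2.1 (by rw [hM]; simp)
    · exact key 0 1 _ hg.1 (by rw [hM]; simp)
    · exact key 1 0 _ hg.2.1 (by rw [hM]; simp)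
    · exact key 1 1 _ hg.2.2.2 (by rw [hM]; simp)
  have hcong' : M.map (Int.castRingHom (ZMod N)) = (p : ZMod N) ^ n • (1 : Matrix (Fin 2) (Fin 2) (ZMod N)) := by
    ext i j
    have := (ZMod.intCast_zmod_eq_zero_iff_dvd _ N).mpr (hcong i j)
    rw [Int.cast_sub, sub_eq_zero] at this
    rw [Matrix.map_apply, eq_intCast, this, Matrix.smul_apply, smul_eq_mul]
    push_cast
    fin_cases i <;> fin_cases j <;> simp
  exact mem_sup_of_smul_eq_map hNp hA hK₀ hK₁ n M _ hq hdet hcong'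

end Away

end IharaAmalgam

end Literature.GroupTheory.ArithmeticGroups
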